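import Summits.QuantumFields.YangMills.Theorems.SwapVirialDeficitBlowUpGnomonicRelationQuaternions
import HarnessLib

/-!
# Route `SwapVirialDeficit` (YangMills): THE APEX NEAR-FLAT PROJECTION IN THE GROUP — a near-commuting pair of gnomonic letters is within `√‖[X̂,Ŷ]‖` of a
# commuting pair with the SAME letter sizes and signs
# (cell ym-idea-1, skeleton ➎ `stub_core_tip` brick (T4a) of w2 g60's memo `w2-g60-memo-24197-tip-assembly.md` §2 (B3): the partner of a tip configuration is the
# apex-flat tuple `(X̂′, X̂′, Ŷ′, 1)`; the distance enters ✓`abs_gnoFolHessianForm_sub_le_leaders` (GROUP distance, so the gnomonic ends are harmless);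
# free-hands support of ⟨stmt-QuantumFields-24197⟩ `SwapVirialDeficit.SwapGluedStiffness`)

For gnomonic letters `X̂ = ν(±(1,x))`, `Ŷ = ν(±(1,y))` (`x, y ∈ ℝ³`):
* §1 ★ `norm_sq_comm_radialUnit_gnoLetter` — the EXACT commutator: `‖X̂Ŷ − ŶX̂‖² = 4|x × y|²∕((1+|x|²)(1+|y|²))` (all three cross components; w3 g67's
  ✓`bfar_comm_zero_two_sq_ge` keeps two), `gram_three` (Lagrange: `|x|²|y|² − (x·y)² = |x × y|²`);
* §2 ★ `norm_sq_radialUnit_gnoLetter_sub_of_normSq_eq` — same sign, same size: `‖ν(±(1,v)) − ν(±(1,v′))‖² = |v − v′|²∕(1+|v|²)`;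
* §3 ★★★ `exists_parallel_near` — for every `x, y` there are `x′, y′` on a COMMON LINE (`x′ = α·e`, `y′ = β·e`, `|e| = 1`) with `|x′| = |x|`, `|y′| = |y|`, one of them
  unchanged, and `‖X̂ − X̂′‖² + ‖Ŷ − Ŷ′‖² ≤ ‖X̂Ŷ − ŶX̂‖` — rotate the axis of the SHORTER letter onto the longer one (`|y| ≤ |x|`: `y′ = ±(|y|∕|x|)·x`); the cost is
  `2|y|(|x||y| − |x·y|)∕(|x|(1+|y|²)) ≤ 2|x × y|∕√((1+|x|²)(1+|y|²))` exactly when `|y| ≤ |x|`.  (At the cone point `x, y → 0` with orthogonal axes the square root is sharp.)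

HONEST LABEL: quaternion ∕ vector algebra; `stub_core_tip`, the other stubs, ⟨24197⟩ ∕ ⟨24194⟩ OPEN; own crux ⟨22884⟩ `LargeFieldMassRefinementTail` OPEN (blocked-on ⟨19935⟩);
the Yang–Mills mass gap is NOT proved; no summit is proved by a line.  THEOREMS ONLY (0 `def`, 0 `sorry`), standard axioms, no instances.
Width seat ym-line-sfw-p2-w2 g60 (cell ym-idea-1, free hands), `--supports stmt-QuantumFields-24197`.  References: [cite: Luscher1983, §2]; [folklore].
-/

set_option autoImplicit false
set_option synthInstance.maxSize 1024

noncomputable section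

open Quaternion Set
open scoped Quaternion BigOperators
open Literature.MathematicalPhysics.QuantumLattice
open Literature.MathematicalPhysics.QuantumFieldTheory hiding SU2
open Literature.Analysis.Calculus (radialUnit radialUnit_def norm_radialUnit)
open Summit.QuantumFields.YangMills.Theorems.SwapVirialDeficit.Gnomonic (normSq3 normSq3_nonneg normSq3_smul)

namespace Summit.QuantumFields.YangMills.Theorems.SwapVirialDeficit.BlowUpRing

/-! ## §1 The exact commutator of two gnomonic letters -/

/-- The real and `i`-components of a commutator: `(XY − YX).re = 0`, `(XY − YX)_I = 2(X_J Y_K − X_K Y_J)`. [folklore] -/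
theorem bfar_comm_re_imI (X Y : ℍ) : (X * Y - Y * X).re = 0 ∧ (X * Y - Y * X).imI = 2 * (X.imJ * Y.imK - X.imK * Y.imJ) := by
  constructor <;> simp <;> ring

/-- Lagrange's identity in `ℝ³`: `|x|²|y|² − (x·y)² = |x × y|²`. [folklore] -/
theorem gram_three (x y : Fin 3 → ℝ) :
    ((x 0) ^ 2 + (x 1) ^ 2 + (x 2) ^ 2) * ((y 0) ^ 2 + (y 1) ^ 2 + (y 2) ^ 2) - (x 0 * y 0 + x 1 * y 1 + x 2 * y 2) ^ 2 =
      (x 1 * y 2 - x 2 * y 1) ^ 2 + (x 2 * y 0 - x 0 * y 2) ^ 2 + (x 0 * y 1 - x 1 * y 0) ^ 2 := by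
  ring

/-- `normSq3 v = (v₀² + v₁²) + v₂²` (left-associated, the shape of the `bfar_*` letters). [folklore] -/
theorem normSq3_eq_three' (v : Fin 3 → ℝ) : normSq3 v = (v 0) ^ 2 + (v 1) ^ 2 + (v 2) ^ 2 := by
  rw [normSq3_eq_three]; ring

/-- Each component is bounded by the size: `(v i)² ≤ |v|²`. [folklore] -/
theorem sq_le_normSq3 (v : Fin 3 → ℝ) (i : Fin 3) : (v i) ^ 2 ≤ normSq3 v :=
  Finset.single_le_sum (f := fun j => (v j) ^ 2) (fun j _ => sq_nonneg (v j)) (Finset.mem_univ i)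

/-- `|v|² = 0 ⟹ v = 0`. [folklore] -/
theorem eq_zero_of_normSq3_eq_zero {v : Fin 3 → ℝ} (h : normSq3 v = 0) : v = 0 := by
  funext i
  have h1 : (v i) ^ 2 ≤ 0 := (sq_le_normSq3 v i).trans h.le
  exact pow_eq_zero_iff (two_ne_zero) |>.1 (le_antisymm h1 (sq_nonneg _))

/-- ★ **THE EXACT COMMUTATOR OF TWO GNOMONIC LETTERS**: `‖X̂Ŷ − ŶX̂‖² = 4|x × y|²∕((1+|x|²)(1+|y|²))`, `X̂ = ν(±(1,x))`, `Ŷ = ν(±(1,y))`, any signs. [folklore] -/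
theorem norm_sq_comm_radialUnit_gnoLetter (εx εy : Bool) (x y : Fin 3 → ℝ) :
    ‖radialUnit (gnoLetter εx x) * radialUnit (gnoLetter εy y) - radialUnit (gnoLetter εy y) * radialUnit (gnoLetter εx x)‖ ^ 2 =
      4 * ((x 1 * y 2 - x 2 * y 1) ^ 2 + (x 2 * y 0 - x 0 * y 2) ^ 2 + (x 0 * y 1 - x 1 * y 0) ^ 2) /
        ((1 + ((x 0) ^ 2 + (x 1) ^ 2 + (x 2) ^ 2)) * (1 + ((y 0) ^ 2 + (y 1) ^ 2 + (y 2) ^ 2))) := by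
  rw [bfar_radialUnit_comm, bfar_norm_smul_sq]
  have hre := (bfar_comm_re_imI (gnoLetter εx x) (gnoLetter εy y)).1
  have hI := (bfar_comm_re_imI (gnoLetter εx x) (gnoLetter εy y)).2
  obtain ⟨eJ, eK⟩ := bfar_comm_imJK (gnoLetter εx x) (gnoLetter εy y)
  obtain ⟨-, x1, x2, x3⟩ := bfar_gnoLetter_components εx x
  obtain ⟨-, y1, y2, y3⟩ := bfar_gnoLetter_components εy y
  have hsx : gnoSign εx ^ 2 = 1 := gnoSign_sq εx
  have hsy : gnoSign εy ^ 2 = 1 := gnoSign_sq εy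
  have hcomm : ‖gnoLetter εx x * gnoLetter εy y - gnoLetter εy y * gnoLetter εx x‖ ^ 2 =
      4 * ((x 1 * y 2 - x 2 * y 1) ^ 2 + (x 2 * y 0 - x 0 * y 2) ^ 2 + (x 0 * y 1 - x 1 * y 0) ^ 2) := by
    rw [sq_norm_eq_sum_sq, hre, hI, eJ, eK, x1, x2, x3, y1, y2, y3]
    have e : ∀ a b c d : ℝ, (gnoSign εx * a * (gnoSign εy * b) - gnoSign εx * c * (gnoSign εy * d)) ^ 2 = (a * b - c * d) ^ 2 := fun a b c d => by
      have : (gnoSign εx * a * (gnoSign εy * b) - gnoSign εx * c * (gnoSign εy * d)) ^ 2 = gnoSign εx ^ 2 * gnoSign εy ^ 2 * (a * b - c * d) ^ 2 := by ring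
      rw [this, hsx, hsy, one_mul, one_mul]
    nlinarith [e (x 1) (y 2) (x 2) (y 1), e (x 2) (y 0) (x 0) (y 2), e (x 0) (y 1) (x 1) (y 0)]
  have hX := bfar_norm_gnoLetter_sq εx x
  have hY := bfar_norm_gnoLetter_sq εy y
  have hXp := bfar_norm_gnoLetter_pos εx x
  have hYp := bfar_norm_gnoLetter_pos εy y
  rw [hcomm, mul_pow, inv_pow, inv_pow, hX, hY]
  field_simp

/-! ## §2 The distance between two letters of the same size -/

/-- ★ **Same sign, same size**: `‖ν(±(1,v)) − ν(±(1,v′))‖² = |v − v′|²∕(1+|v|²)` when `|v′| = |v|` (the real parts agree, the imaginary parts differ by `(v − v′)∕√(1+|v|²)`).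
[folklore] -/
theorem norm_sq_radialUnit_gnoLetter_sub_of_normSq_eq (ε : Bool) {v v' : Fin 3 → ℝ} (h : normSq3 v' = normSq3 v) :
    ‖radialUnit (gnoLetter ε v) - radialUnit (gnoLetter ε v')‖ ^ 2 = normSq3 (v - v') / (1 + normSq3 v) := by
  have hn : ‖gnoLetter ε v'‖ = ‖gnoLetter ε v‖ := by
    have h1 := bfar_norm_gnoLetter_sq ε v
    have h2 := bfar_norm_gnoLetter_sq ε v'
    rw [← normSq3_eq_three'] at h1 h2
    rw [h] at h2
    exact (sq_eq_sq₀ (norm_nonneg _) (norm_nonneg _)).1 (h2.trans h1.symm)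
  obtain ⟨r0, r1, r2, r3⟩ := bfar_gnoLetter_components ε v
  obtain ⟨s0, s1, s2, s3⟩ := bfar_gnoLetter_components ε v'
  have hs : gnoSign ε ^ 2 = 1 := gnoSign_sq ε
  have hX := bfar_norm_gnoLetter_sq ε v
  have hXp := bfar_norm_gnoLetter_pos ε v
  have hdiff : ‖gnoLetter ε v - gnoLetter ε v'‖ ^ 2 = gnoSign ε ^ 2 * normSq3 (v - v') := by
    rw [sq_norm_eq_sum_sq, normSq3_eq_three']
    simp only [Quaternion.re_sub, Quaternion.imI_sub, Quaternion.imJ_sub, Quaternion.imK_sub, r0, r1, r2, r3, s0, s1, s2, s3, sub_self, Pi.sub_apply]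
    ring
  rw [radialUnit_def, radialUnit_def, hn, ← smul_sub, bfar_norm_smul_sq, hdiff, hs, one_mul, inv_pow, hX, ← normSq3_eq_three' v, div_eq_inv_mul]

/-! ## §3 The projection onto commuting pairs -/

set_option maxHeartbeats 400000 in
/-- The core case `|y| ≤ |x|`, `x ≠ 0`: rotating the axis of `y` onto the line of `x` (keeping its size and sign) costs at most `√‖X̂Ŷ − ŶX̂‖`:
`y′ = c·x` with `|y′| = |y|` and `‖Ŷ − Ŷ′‖² ≤ ‖X̂Ŷ − ŶX̂‖`. [folklore] -/
theorem exists_parallel_near_core (εx εy : Bool) {x y : Fin 3 → ℝ} (hx : 0 < normSq3 x) (hle : normSq3 y ≤ normSq3 x) :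
    ∃ c : ℝ, normSq3 (c • x) = normSq3 y ∧
      ‖radialUnit (gnoLetter εy y) - radialUnit (gnoLetter εy (c • x))‖ ^ 2 ≤
        ‖radialUnit (gnoLetter εx x) * radialUnit (gnoLetter εy y) - radialUnit (gnoLetter εy y) * radialUnit (gnoLetter εx x)‖ := by
  -- sizes `a = |x|`, `b = |y|`, dot product `d`
  set A : ℝ := normSq3 x with hA
  set B : ℝ := normSq3 y with hB
  set d : ℝ := x 0 * y 0 + x 1 * y 1 + x 2 * y 2 with hd
  set a : ℝ := Real.sqrt A with ha
  set b : ℝ := Real.sqrt B with hb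
  have hA3 : A = (x 0) ^ 2 + (x 1) ^ 2 + (x 2) ^ 2 := normSq3_eq_three' x
  have hB3 : B = (y 0) ^ 2 + (y 1) ^ 2 + (y 2) ^ 2 := normSq3_eq_three' y
  have hB0 : 0 ≤ B := normSq3_nonneg y
  have ha0 : 0 < a := Real.sqrt_pos.2 hx
  have hb0 : 0 ≤ b := Real.sqrt_nonneg _
  have ha2 : a ^ 2 = A := Real.sq_sqrt hx.le
  have hb2 : b ^ 2 = B := Real.sq_sqrt hB0
  have hba : b ≤ a := Real.sqrt_le_sqrt hle
  -- Gram ≥ 0 and Cauchy–Schwarz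
  set G : ℝ := (x 1 * y 2 - x 2 * y 1) ^ 2 + (x 2 * y 0 - x 0 * y 2) ^ 2 + (x 0 * y 1 - x 1 * y 0) ^ 2 with hG
  have hgram : A * B - d ^ 2 = G := by rw [hA3, hB3, hd, hG]; exact gram_three x y
  have hG0 : 0 ≤ G := by rw [hG]; positivity
  have hd2 : d ^ 2 ≤ (a * b) ^ 2 := by rw [mul_pow, ha2, hb2]; linarith
  have hCS : |d| ≤ a * b := abs_le_of_sq_le_sq hd2 (by positivity)
  -- the scalar `c = ± b∕a` with `c·d = (b∕a)|d|`
  set c : ℝ := if 0 ≤ d then b / a else -(b / a) with hc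
  have hc2 : c ^ 2 = b ^ 2 / a ^ 2 := by
    rw [hc]; split_ifs <;> field_simp
  have hcd : c * d = b / a * |d| := by
    rw [hc]; split_ifs with h
    · rw [abs_of_nonneg h]
    · rw [abs_of_neg (not_le.1 h)]; ring
  -- (1) the size is kept
  have hsize : normSq3 (c • x) = normSq3 y := by
    show normSq3 (c • x) = B
    rw [normSq3_smul, ← hA, hc2, ← ha2, ← hb2]
    field_simp
  refine ⟨c, hsize, ?_⟩
  -- (2) the cost
  set t : ℝ := a * b - |d| with htdef
  have ht0 : 0 ≤ t := by rw [htdef]; linarith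
  have htab : t ≤ a * b := by rw [htdef]; linarith [abs_nonneg d]
  have hGt : t * (a * b) ≤ G := by
    have hdabs : |d| ^ 2 = d ^ 2 := sq_abs d
    have e : G = t * (a * b + |d|) := by
      rw [htdef]
      linear_combination (-1 : ℝ) * hgram - B * ha2 - a ^ 2 * hb2 + hdabs
    rw [e, mul_add]
    have h1 : 0 ≤ t * |d| := mul_nonneg ht0 (abs_nonneg d)
    linarith
  have hcost : ‖radialUnit (gnoLetter εy y) - radialUnit (gnoLetter εy (c • x))‖ ^ 2 = 2 * b * t / (a * (1 + B)) := by
    rw [norm_sq_radialUnit_gnoLetter_sub_of_normSq_eq εy hsize]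
    have hnum : normSq3 (y - c • x) = 2 * b * t / a := by
      rw [normSq3_eq_three']
      simp only [Pi.sub_apply, Pi.smul_apply, smul_eq_mul]
      have e : (y 0 - c * x 0) ^ 2 + (y 1 - c * x 1) ^ 2 + (y 2 - c * x 2) ^ 2 = B - 2 * (c * d) + c ^ 2 * A := by rw [hB3, hd, hA3]; ring
      rw [e, hcd, hc2, htdef, ← ha2, ← hb2]
      field_simp
      ring
    rw [hnum, ← hB]
    field_simp
  -- (3) the commutator
  have hε2 := norm_sq_comm_radialUnit_gnoLetter εx εy x y
  rw [← hA3, ← hB3, ← hG] at hε2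
  -- (4) `cost² ≤ ε` via squares
  have hA0 : 0 ≤ A := hx.le
  have hBA : B * (1 + A) ≤ A * (1 + B) := by nlinarith
  have key : b ^ 2 * t ^ 2 * (1 + A) ≤ G * a ^ 2 * (1 + B) := by
    have htab0 : 0 ≤ t * (a * b) := by positivity
    calc b ^ 2 * t ^ 2 * (1 + A) = t * (b ^ 2 * (1 + A)) * t := by ring
      _ ≤ t * (b ^ 2 * (1 + A)) * (a * b) := mul_le_mul_of_nonneg_left htab (by positivity)
      _ = t * (a * b) * (B * (1 + A)) := by rw [← hb2]; ring
      _ ≤ t * (a * b) * (A * (1 + B)) := mul_le_mul_of_nonneg_left hBA htab0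
      _ = t * (a * b) * (a ^ 2 * (1 + B)) := by rw [ha2]
      _ ≤ G * (a ^ 2 * (1 + B)) := mul_le_mul_of_nonneg_right hGt (by positivity)
      _ = G * a ^ 2 * (1 + B) := by ring
  have hc0 : 0 ≤ 2 * b * t / (a * (1 + B)) := by positivity
  have hε0 : 0 ≤ ‖radialUnit (gnoLetter εx x) * radialUnit (gnoLetter εy y) - radialUnit (gnoLetter εy y) * radialUnit (gnoLetter εx x)‖ := norm_nonneg _
  rw [hcost]
  refine (pow_le_pow_iff_left₀ hc0 hε0 two_ne_zero).1 ?_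
  rw [hε2, div_pow, div_le_div_iff₀ (by positivity) (by positivity)]
  calc (2 * b * t) ^ 2 * ((1 + A) * (1 + B)) = 4 * (b ^ 2 * t ^ 2 * (1 + A)) * (1 + B) := by ring
    _ ≤ 4 * (G * a ^ 2 * (1 + B)) * (1 + B) := by
        have h1B : 0 ≤ 1 + B := by positivity
        nlinarith [key, h1B]
    _ = 4 * G * (a * (1 + B)) ^ 2 := by ring

/-- ★★★ **THE APEX NEAR-FLAT PROJECTION**: for all gnomonic letters `x, y ∈ ℝ³` (signs `εx, εy`) there are letters `x′, y′` ON A COMMON LINE — `x′ = α·e`, `y′ = β·e` for a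
unit vector `e` — with the SAME sizes `|x′| = |x|`, `|y′| = |y|`, and `‖X̂ − X̂′‖² + ‖Ŷ − Ŷ′‖² ≤ ‖X̂Ŷ − ŶX̂‖` (`X̂ = ν(±(1,x))`, …; the pair `(X̂′, Ŷ′)` commutes — it lies
in the plane spanned by `1` and `e`).  With ✓`norm_sq_comm_radialUnit_gnoLetter` and w3 g67's ✓`gnoDeficit_floor_yAxial`∕✓`bfar_rel_comm02`, the right side is
`≤ (1800L⁶F̂)^{1∕2}`-type: polynomial in `F̂`. [folklore] -/
theorem exists_parallel_near (εx εy : Bool) (x y : Fin 3 → ℝ) :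
    ∃ (x' y' e : Fin 3 → ℝ) (α β : ℝ), normSq3 e = 1 ∧ x' = α • e ∧ y' = β • e ∧ normSq3 x' = normSq3 x ∧ normSq3 y' = normSq3 y ∧
      ‖radialUnit (gnoLetter εx x) - radialUnit (gnoLetter εx x')‖ ^ 2 + ‖radialUnit (gnoLetter εy y) - radialUnit (gnoLetter εy y')‖ ^ 2 ≤
        ‖radialUnit (gnoLetter εx x) * radialUnit (gnoLetter εy y) - radialUnit (gnoLetter εy y) * radialUnit (gnoLetter εx x)‖ := by
  have hε0 : 0 ≤ ‖radialUnit (gnoLetter εx x) * radialUnit (gnoLetter εy y) - radialUnit (gnoLetter εy y) * radialUnit (gnoLetter εx x)‖ := norm_nonneg _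
  -- the unit vector of a non-zero letter
  have unitOf : ∀ v : Fin 3 → ℝ, 0 < normSq3 v → normSq3 ((Real.sqrt (normSq3 v))⁻¹ • v) = 1 ∧ v = Real.sqrt (normSq3 v) • ((Real.sqrt (normSq3 v))⁻¹ • v) := by
    intro v hv
    have hs : 0 < Real.sqrt (normSq3 v) := Real.sqrt_pos.2 hv
    have hs2 : Real.sqrt (normSq3 v) ^ 2 = normSq3 v := Real.sq_sqrt hv.le
    refine ⟨?_, ?_⟩
    · rw [normSq3_smul, inv_pow, hs2, inv_mul_cancel₀ hv.ne']
    · rw [smul_smul, mul_inv_cancel₀ hs.ne', one_smul]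
  by_cases hx0 : normSq3 x = 0
  · -- `x = 0`: keep both letters; `e` from `y` (or any unit vector)
    have hxz : x = 0 := eq_zero_of_normSq3_eq_zero hx0
    by_cases hy0 : normSq3 y = 0
    · have hyz : y = 0 := eq_zero_of_normSq3_eq_zero hy0
      refine ⟨x, y, ![1, 0, 0], 0, 0, ?_, ?_, ?_, rfl, rfl, ?_⟩
      · simp [normSq3_eq_three']
      · rw [hxz, zero_smul]
      · rw [hyz, zero_smul]
      · simp only [sub_self, norm_zero]; nlinarith
    · obtain ⟨he, hye⟩ := unitOf y (lt_of_le_of_ne (normSq3_nonneg y) (Ne.symm hy0))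
      refine ⟨x, y, (Real.sqrt (normSq3 y))⁻¹ • y, 0, Real.sqrt (normSq3 y), he, ?_, hye, rfl, rfl, ?_⟩
      · rw [hxz, zero_smul]
      · simp only [sub_self, norm_zero]; nlinarith
  · have hx : 0 < normSq3 x := lt_of_le_of_ne (normSq3_nonneg x) (Ne.symm hx0)
    by_cases hle : normSq3 y ≤ normSq3 x
    · -- rotate `y` onto the line of `x`
      obtain ⟨c, hsize, hcost⟩ := exists_parallel_near_core εx εy hx hle
      obtain ⟨he, hxe⟩ := unitOf x hx
      refine ⟨x, c • x, (Real.sqrt (normSq3 x))⁻¹ • x, Real.sqrt (normSq3 x), c * Real.sqrt (normSq3 x), he, hxe, ?_, rfl, hsize, ?_⟩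
      · rw [← smul_smul, ← hxe]
      · simp only [sub_self, norm_zero]; nlinarith
    · -- rotate `x` onto the line of `y`
      have hy : 0 < normSq3 y := lt_of_lt_of_le hx (le_of_lt (not_le.1 hle))
      obtain ⟨c, hsize, hcost⟩ := exists_parallel_near_core εy εx hy (le_of_lt (not_le.1 hle))
      obtain ⟨he, hye⟩ := unitOf y hy
      have hsymm : ‖radialUnit (gnoLetter εy y) * radialUnit (gnoLetter εx x) - radialUnit (gnoLetter εx x) * radialUnit (gnoLetter εy y)‖ =
          ‖radialUnit (gnoLetter εx x) * radialUnit (gnoLetter εy y) - radialUnit (gnoLetter εy y) * radialUnit (gnoLetter εx x)‖ := by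
        rw [← norm_neg, neg_sub]
      rw [hsymm] at hcost
      refine ⟨c • y, y, (Real.sqrt (normSq3 y))⁻¹ • y, c * Real.sqrt (normSq3 y), Real.sqrt (normSq3 y), he, ?_, hye, hsize, rfl, ?_⟩
      · rw [← smul_smul, ← hye]
      · simp only [sub_self, norm_zero]; nlinarith

end Summit.QuantumFields.YangMills.Theorems.SwapVirialDeficit.BlowUpRing

end
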